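import Mathlib
import HarnessLib

/-!
HONEST FRAMING: exact (Metropolis-corrected) sampling algorithms for lattice gauge theory; figures
of merit are autocorrelation/cost numbers at stated couplings and volumes; no continuum-physics
claim.

# GraphGroundState — THE ONE INPUT OF CHAPTER AH EXISTS ON EVERY CONNECTED SWAP LIST: A POSITIVE VECTOR `c` AND A RATE `0 < ρ ≤ h/(K+1)` SOLVING THE VERTEX EQUATIONS
# `(t/m)Σ_r[1{k=i_r}(c_{l_r}−c_{i_r}) + 1{k=l_r}(c_{i_r}−c_{l_r})] − 1{k=0}h·c_k = −ρ·c_k`, WITH `Σ_kc_k² = 1` (the Perron ground state of `I − (t/m)L_G − h·e_0e_0ᵀ`, variationally)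
# (lean-2 GEN-47, ours)

Venture-side (OURS).  Cell `lqcd-flow` (pub-lqcd), unit `pub-lqcd-lean-2-g47`, 2026-08-31.  Chapter AH (the hub–ladder interpolation), file 8 — Mathlib only.  Files 2 and 7 turn a positive
solution of the vertex equations into the two-sided mixing law of the homogeneous exchange scheme on a swap list; this file supplies the solution for EVERY list whose multigraph is
connected (every non-empty proper set of levels is left by some entry) with `t, h > 0`, `h ≤ K+1`… precisely `0 < h`.  ROUTE (no spectral theorem, no calculus): the quadratic form
`q(v) = Σ_kv_k² − (t/m)Σ_r(v_{i_r} − v_{l_r})² − h·v_0²` (`= ⟨v, Qv⟩`) attains its maximum `λ` on the compact sphere `Σv² = 1` at some `v`; `|v|` is again a maximiser (edge terms only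
shrink); for a maximiser `c` the non-negative quadratic `s ↦ λ|c + s·e_k|² − q(c + s·e_k)` vanishes at `0`, so its linear coefficient vanishes — these are the vertex equations with
`ρ = 1 − λ`; `λ ≥ q(𝟙)/(K+1) = 1 − h/(K+1)`; a zero entry of `c ≥ 0` would force its neighbours to vanish (the vertex equation at that level is a sum of non-negative terms), so by
connectivity `c > 0`, and then `ρ = (t/m)Σ_r(c_{i_r} − c_{l_r})² + h·c_0² ≥ h·c_0² > 0`.  No definitions (the form and the vertex operator are written out).

* §1 `gs_form_pairing` (`Σ_kw_k·V(v)_k` in edge form), `gs_form_smul`, `gs_form_abs_ge`, `gs_form_add_single` (the expansion along a coordinate), `gs_psd_linear_zero` (a non-negative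
  quadratic `2sA + s²B` forces `A = 0`); §2 **`graph_groundState_exists`**.

Reading (no numerics implied): with files 2 and 7, EVERY connected swap topology has the two-sided law `((1−ρ)/ρ)·log((1−ν(u))Σc/(4D)) ≤ t_mix(1/4) ≤ ⌈(1/ρ)·log(4Σc/c_min)⌉` with its own
Robin ground state; what remains topology-specific are the sizes `ρ`, `Σc/c_min` and the edge differences (the path: chapter AG; the star: file 3).  Literature grade (cell rule): ELEMENTARY
(Perron–Frobenius for a symmetric matrix with non-negative off-diagonal entries, variationally), NEW TYPING; nothing cited; no new bib keys.
-/

noncomputable section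

open Finset

namespace Summit.Ventures.LatticeQCDFlow.Scaling

section GroundState
variable {K m : ℕ} (e : Fin m → Fin (K + 1) × Fin (K + 1)) {t h : ℝ}

/-! ## §1 The quadratic form -/

/-- **Edge form of the vertex operator paired with a vector:** `Σ_k w_k·Σ_r[1{k=i_r}(v_{l_r}−v_{i_r}) + 1{k=l_r}(v_{i_r}−v_{l_r})] = −Σ_r(v_{i_r} − v_{l_r})(w_{i_r} − w_{l_r})`. [ours] -/
theorem gs_form_pairing (v w : Fin (K + 1) → ℝ) :
    ∑ k : Fin (K + 1), w k * ∑ r : Fin m, ((if k = (e r).1 then v (e r).2 - v (e r).1 else 0) + (if k = (e r).2 then v (e r).1 - v (e r).2 else 0))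
      = -∑ r : Fin m, (v (e r).1 - v (e r).2) * (w (e r).1 - w (e r).2) := by
  simp_rw [mul_sum]
  rw [sum_comm, ← sum_neg_distrib]
  refine sum_congr rfl fun r _ => ?_
  simp_rw [mul_add, mul_ite, mul_zero]
  rw [sum_add_distrib, sum_ite_eq' univ (e r).1, sum_ite_eq' univ (e r).2, if_pos (mem_univ _), if_pos (mem_univ _)]
  ring

/-- Homogeneity of the form: `q(s·v) = s²·q(v)`. [ours] -/
theorem gs_form_smul (v : Fin (K + 1) → ℝ) (s : ℝ) :
    (∑ k : Fin (K + 1), (s * v k) ^ 2 - t / m * ∑ r : Fin m, (s * v (e r).1 - s * v (e r).2) ^ 2 - h * (s * v 0) ^ 2)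
      = s ^ 2 * (∑ k : Fin (K + 1), v k ^ 2 - t / m * ∑ r : Fin m, (v (e r).1 - v (e r).2) ^ 2 - h * v 0 ^ 2) := by
  have e1 : ∑ k : Fin (K + 1), (s * v k) ^ 2 = s ^ 2 * ∑ k : Fin (K + 1), v k ^ 2 := by rw [mul_sum]; exact sum_congr rfl fun k _ => by ring
  have e2 : ∑ r : Fin m, (s * v (e r).1 - s * v (e r).2) ^ 2 = s ^ 2 * ∑ r : Fin m, (v (e r).1 - v (e r).2) ^ 2 := by rw [mul_sum]; exact sum_congr rfl fun r _ => by ring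
  rw [e1, e2]; ring

/-- **Taking absolute values does not decrease the form** (`t/m ≥ 0`): `q(|v|) ≥ q(v)` since `(|a| − |b|)² ≤ (a − b)²`. [ours] -/
theorem gs_form_abs_ge (htm : 0 ≤ t / m) (v : Fin (K + 1) → ℝ) :
    (∑ k : Fin (K + 1), v k ^ 2 - t / m * ∑ r : Fin m, (v (e r).1 - v (e r).2) ^ 2 - h * v 0 ^ 2)
      ≤ (∑ k : Fin (K + 1), |v k| ^ 2 - t / m * ∑ r : Fin m, (|v (e r).1| - |v (e r).2|) ^ 2 - h * |v 0| ^ 2) := by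
  simp_rw [sq_abs]
  have : ∑ r : Fin m, (|v (e r).1| - |v (e r).2|) ^ 2 ≤ ∑ r : Fin m, (v (e r).1 - v (e r).2) ^ 2 := by
    refine sum_le_sum fun r _ => ?_
    have h1 := abs_abs_sub_abs_le_abs_sub (v (e r).1) (v (e r).2)
    rw [← sq_abs (|v (e r).1| - |v (e r).2|), ← sq_abs (v (e r).1 - v (e r).2)]
    exact pow_le_pow_left₀ (abs_nonneg _) h1 2
  nlinarith [mul_le_mul_of_nonneg_left this htm]

/-- **The expansion along a coordinate:** with `e_k = 1{· = k}`,
`q(c + s·e_k) = q(c) + 2s·(c_k + V(c)_k) + s²·q(e_k)`, where `V(c)_k = (t/m)Σ_r[1{k=i_r}(c_{l_r}−c_{i_r}) + 1{k=l_r}(c_{i_r}−c_{l_r})] − 1{k=0}h·c_k`. [ours] -/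
theorem gs_form_add_single (c : Fin (K + 1) → ℝ) (k : Fin (K + 1)) (s : ℝ) :
    (∑ j : Fin (K + 1), (c j + s * (if j = k then 1 else 0)) ^ 2
        - t / m * ∑ r : Fin m, ((c (e r).1 + s * (if (e r).1 = k then 1 else 0)) - (c (e r).2 + s * (if (e r).2 = k then 1 else 0))) ^ 2
        - h * (c 0 + s * (if (0 : Fin (K + 1)) = k then 1 else 0)) ^ 2)
      = (∑ j : Fin (K + 1), c j ^ 2 - t / m * ∑ r : Fin m, (c (e r).1 - c (e r).2) ^ 2 - h * c 0 ^ 2)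
        + 2 * s * (c k + (t / m * ∑ r : Fin m, ((if k = (e r).1 then c (e r).2 - c (e r).1 else 0) + (if k = (e r).2 then c (e r).1 - c (e r).2 else 0))
            - (if k = 0 then h * c k else 0)))
        + s ^ 2 * (∑ j : Fin (K + 1), (if j = k then (1 : ℝ) else 0) ^ 2
            - t / m * ∑ r : Fin m, ((if (e r).1 = k then (1 : ℝ) else 0) - (if (e r).2 = k then (1 : ℝ) else 0)) ^ 2
            - h * (if (0 : Fin (K + 1)) = k then (1 : ℝ) else 0) ^ 2) := by
  -- the three pieces separately
  have p1 : ∑ j : Fin (K + 1), (c j + s * (if j = k then 1 else 0)) ^ 2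
      = ∑ j : Fin (K + 1), c j ^ 2 + 2 * s * c k + s ^ 2 * ∑ j : Fin (K + 1), (if j = k then (1 : ℝ) else 0) ^ 2 := by
    have ex : ∀ j : Fin (K + 1), (c j + s * (if j = k then 1 else 0)) ^ 2 = c j ^ 2 + 2 * s * (if j = k then c j else 0) + s ^ 2 * (if j = k then (1 : ℝ) else 0) ^ 2 := by
      intro j; split_ifs with hj
      · subst hj; ring
      · ring
    simp_rw [ex, sum_add_distrib, ← mul_sum]
    rw [sum_ite_eq' univ k, if_pos (mem_univ _)]
  have p2 : ∑ r : Fin m, ((c (e r).1 + s * (if (e r).1 = k then 1 else 0)) - (c (e r).2 + s * (if (e r).2 = k then 1 else 0))) ^ 2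
      = ∑ r : Fin m, (c (e r).1 - c (e r).2) ^ 2
        - 2 * s * ∑ r : Fin m, ((if k = (e r).1 then c (e r).2 - c (e r).1 else 0) + (if k = (e r).2 then c (e r).1 - c (e r).2 else 0))
        + s ^ 2 * ∑ r : Fin m, ((if (e r).1 = k then (1 : ℝ) else 0) - (if (e r).2 = k then (1 : ℝ) else 0)) ^ 2 := by
    rw [mul_sum, mul_sum, ← sum_sub_distrib, ← sum_add_distrib]
    refine sum_congr rfl fun r _ => ?_
    by_cases h1 : (e r).1 = k <;> by_cases h2 : (e r).2 = k
    · rw [if_pos h1, if_pos h2, if_pos h1.symm, if_pos h2.symm]; ring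
    · rw [if_pos h1, if_neg h2, if_pos h1.symm, if_neg (fun h' => h2 h'.symm)]; ring
    · rw [if_neg h1, if_pos h2, if_neg (fun h' => h1 h'.symm), if_pos h2.symm]; ring
    · rw [if_neg h1, if_neg h2, if_neg (fun h' => h1 h'.symm), if_neg (fun h' => h2 h'.symm)]; ring
  have p3 : h * (c 0 + s * (if (0 : Fin (K + 1)) = k then 1 else 0)) ^ 2
      = h * c 0 ^ 2 + 2 * s * (if k = 0 then h * c k else 0) + s ^ 2 * (h * (if (0 : Fin (K + 1)) = k then (1 : ℝ) else 0) ^ 2) := by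
    by_cases hk : k = 0
    · subst hk; rw [if_pos rfl, if_pos rfl]; ring
    · rw [if_neg (fun h' => hk h'.symm), if_neg hk]; ring
  rw [p1, p2, p3]; ring

/-- A quadratic `s ↦ 2sA + s²B` that is non-negative for all `s` (with `B ≥ 0`) has `A = 0`. [ours] -/
theorem gs_psd_linear_zero {A B : ℝ} (hB : 0 ≤ B) (hq : ∀ s : ℝ, 0 ≤ 2 * s * A + s ^ 2 * B) : A = 0 := by
  by_contra hA
  have hB1 : 0 < B + 1 := by linarith
  have hq' := hq (-A / (B + 1))
  have e' : 2 * (-A / (B + 1)) * A + (-A / (B + 1)) ^ 2 * B = -(A ^ 2 * (B + 2)) / (B + 1) ^ 2 := by field_simp; ring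
  rw [e'] at hq'
  have hA2 : 0 < A ^ 2 := by positivity
  have : 0 < A ^ 2 * (B + 2) / (B + 1) ^ 2 := by positivity
  rw [neg_div] at hq'
  linarith

/-! ## §2 The ground state -/

/-- **THE GROUND STATE OF A CONNECTED SWAP LIST:** `m ≥ 1`, `t > 0`, `h > 0`, and every non-empty proper set of levels is crossed by some listed pair ⇒ there are `c : levels → ℝ` and `ρ` with
**`c_k > 0` for all `k`, `Σ_kc_k² = 1`, `0 < ρ ≤ h/(K+1)`, and the vertex equations `(t/m)Σ_r[1{k=i_r}(c_{l_r}−c_{i_r}) + 1{k=l_r}(c_{i_r}−c_{l_r})] − 1{k=0}h·c_k = −ρ·c_k`**. [ours] -/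
theorem graph_groundState_exists (hm : 1 ≤ m) (ht0 : 0 < t) (hh0 : 0 < h)
    (hconn : ∀ A : Finset (Fin (K + 1)), A.Nonempty → A ≠ univ → ∃ r : Fin m, ((e r).1 ∈ A ∧ (e r).2 ∉ A) ∨ ((e r).2 ∈ A ∧ (e r).1 ∉ A)) :
    ∃ (c : Fin (K + 1) → ℝ) (ρ : ℝ), (∀ k, 0 < c k) ∧ ∑ k : Fin (K + 1), c k ^ 2 = 1 ∧ 0 < ρ ∧ ρ ≤ h / ((K : ℝ) + 1) ∧
      ∀ k : Fin (K + 1), t / m * ∑ r : Fin m, ((if k = (e r).1 then c (e r).2 - c (e r).1 else 0) + (if k = (e r).2 then c (e r).1 - c (e r).2 else 0))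
        - (if k = 0 then h * c k else 0) = -ρ * c k := by
  have hmpos : (0 : ℝ) < m := Nat.cast_pos.mpr (by omega)
  have htm : 0 ≤ t / m := by positivity
  -- the form and the sphere
  set q : (Fin (K + 1) → ℝ) → ℝ := fun v => ∑ k : Fin (K + 1), v k ^ 2 - t / m * ∑ r : Fin m, (v (e r).1 - v (e r).2) ^ 2 - h * v 0 ^ 2 with hq
  set Sph : Set (Fin (K + 1) → ℝ) := {v | ∑ k : Fin (K + 1), v k ^ 2 = 1} with hSph
  have hcont : ContinuousOn q Sph := by
    apply Continuous.continuousOn; rw [hq]; fun_prop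
  have hclosed : IsClosed Sph := by
    rw [hSph]; exact isClosed_eq (by fun_prop) continuous_const
  have hsub : Sph ⊆ Metric.closedBall (0 : Fin (K + 1) → ℝ) 1 := by
    intro v hv
    rw [Metric.mem_closedBall, dist_zero_right, pi_norm_le_iff_of_nonneg zero_le_one]
    intro k
    rw [Real.norm_eq_abs]
    have hk : v k ^ 2 ≤ ∑ j : Fin (K + 1), v j ^ 2 := Finset.single_le_sum (fun j _ => sq_nonneg (v j)) (mem_univ k)
    have hv' : ∑ j : Fin (K + 1), v j ^ 2 = 1 := hv
    rw [hv'] at hk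
    exact abs_le_one_iff_mul_self_le_one.mpr (by nlinarith)
  have hcompact : IsCompact Sph := (isCompact_closedBall (0 : Fin (K + 1) → ℝ) 1).of_isClosed_subset hclosed hsub
  have hne : Sph.Nonempty := ⟨fun j => if j = 0 then 1 else 0, by
    show ∑ k : Fin (K + 1), (if k = 0 then (1 : ℝ) else 0) ^ 2 = 1
    simp_rw [ite_pow, one_pow, zero_pow two_ne_zero]
    rw [sum_ite_eq' univ (0 : Fin (K + 1)), if_pos (mem_univ _)]⟩
  obtain ⟨v, hvS, hvmax⟩ := hcompact.exists_isMaxOn hne hcont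
  have hvS' : ∑ k : Fin (K + 1), v k ^ 2 = 1 := hvS
  set lam : ℝ := q v with hlam
  -- `q(u) ≤ λ·Σu²` for every `u`
  have hB : ∀ u : Fin (K + 1) → ℝ, q u ≤ lam * ∑ k : Fin (K + 1), u k ^ 2 := by
    intro u
    by_cases hu : ∑ k : Fin (K + 1), u k ^ 2 = 0
    · have hu0 : ∀ k, u k = 0 := fun k => by
        have := (Finset.sum_eq_zero_iff_of_nonneg fun j _ => sq_nonneg (u j)).mp hu k (mem_univ k)
        exact pow_eq_zero_iff (n := 2) (by norm_num) |>.mp this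
      have : q u = 0 := by rw [hq]; simp [hu0]
      rw [this, hu, mul_zero]
    · have hpos : 0 < ∑ k : Fin (K + 1), u k ^ 2 := lt_of_le_of_ne (sum_nonneg fun j _ => sq_nonneg (u j)) (Ne.symm hu)
      set s : ℝ := Real.sqrt (∑ k : Fin (K + 1), u k ^ 2) with hs
      have hs0 : 0 < s := Real.sqrt_pos.mpr hpos
      have hss : s ^ 2 = ∑ k : Fin (K + 1), u k ^ 2 := by rw [hs, Real.sq_sqrt hpos.le]
      -- `u/s ∈ Sph`
      have hmem : (fun k => s⁻¹ * u k) ∈ Sph := by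
        show ∑ k : Fin (K + 1), (s⁻¹ * u k) ^ 2 = 1
        have : ∑ k : Fin (K + 1), (s⁻¹ * u k) ^ 2 = s⁻¹ ^ 2 * ∑ k : Fin (K + 1), u k ^ 2 := by rw [mul_sum]; exact sum_congr rfl fun k _ => by ring
        rw [this, ← hss]; field_simp
      have hle := hvmax hmem
      have hsm := gs_form_smul e (t := t) (h := h) u s⁻¹
      have hq' : q (fun k => s⁻¹ * u k) = s⁻¹ ^ 2 * q u := by rw [hq]; exact hsm
      have hle' : s⁻¹ ^ 2 * q u ≤ lam := by rw [← hq']; exact hle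
      rw [← hss]
      have : q u = s ^ 2 * (s⁻¹ ^ 2 * q u) := by field_simp
      rw [this]
      nlinarith [sq_nonneg s]
  -- the absolute value is a maximiser too
  set c : Fin (K + 1) → ℝ := fun k => |v k| with hc
  have hcS : ∑ k : Fin (K + 1), c k ^ 2 = 1 := by simp_rw [hc, sq_abs]; exact hvS'
  have hqc : q c = lam := by
    apply le_antisymm
    · have := hB c; rw [hcS, mul_one] at this; exact this
    · rw [hlam, hq]; exact gs_form_abs_ge e htm v
  -- `λ ≥ 1 − h/(K+1)` from the constant vector, `λ ≤ 1` from `e_0`… and the vertex equations by the PSD argument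
  have hlam_ge : 1 - h / ((K : ℝ) + 1) ≤ lam := by
    have h1 := hB (fun _ => (1 : ℝ))
    have hq1 : q (fun _ => (1 : ℝ)) = ((K : ℝ) + 1) - h := by
      rw [hq]; simp
    simp only [one_pow, sum_const, card_univ, Fintype.card_fin, nsmul_eq_mul, mul_one] at h1
    rw [hq1] at h1
    push_cast at h1
    have hK1 : (0 : ℝ) < (K : ℝ) + 1 := by positivity
    have h2 : (1 - h / ((K : ℝ) + 1)) * ((K : ℝ) + 1) ≤ lam * ((K : ℝ) + 1) := by
      rw [sub_mul, div_mul_cancel₀ _ hK1.ne', one_mul]; linarith [h1]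
    exact le_of_mul_le_mul_right h2 hK1
  -- the vertex equations for `c` with `ρ = 1 − λ`
  have hvertex : ∀ k : Fin (K + 1), t / m * ∑ r : Fin m, ((if k = (e r).1 then c (e r).2 - c (e r).1 else 0) + (if k = (e r).2 then c (e r).1 - c (e r).2 else 0))
      - (if k = 0 then h * c k else 0) = -(1 - lam) * c k := by
    intro k
    -- `P(s) = λ|c + s e_k|² − q(c + s e_k) = 2s(λc_k − G_k) + s²(λ − q(e_k)) ≥ 0`
    set G : ℝ := c k + (t / m * ∑ r : Fin m, ((if k = (e r).1 then c (e r).2 - c (e r).1 else 0) + (if k = (e r).2 then c (e r).1 - c (e r).2 else 0))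
        - (if k = 0 then h * c k else 0)) with hG
    set ek : Fin (K + 1) → ℝ := fun j => if j = k then 1 else 0 with hek
    have hekS : ∑ j : Fin (K + 1), ek j ^ 2 = 1 := by
      simp_rw [hek, ite_pow, one_pow, zero_pow two_ne_zero]; rw [sum_ite_eq' univ k, if_pos (mem_univ _)]
    have hBk : 0 ≤ lam - q ek := by have := hB ek; rw [hekS, mul_one] at this; linarith
    have hexp : ∀ s : ℝ, q (fun j => c j + s * ek j) = q c + 2 * s * G + s ^ 2 * q ek := by
      intro s
      have := gs_form_add_single e (t := t) (h := h) c k s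
      rw [hq, hG, hek]
      exact this
    have hnorm : ∀ s : ℝ, ∑ j : Fin (K + 1), (c j + s * ek j) ^ 2 = 1 + 2 * s * c k + s ^ 2 := by
      intro s
      have ex : ∀ j : Fin (K + 1), (c j + s * ek j) ^ 2 = c j ^ 2 + 2 * s * (if j = k then c j else 0) + s ^ 2 * ek j ^ 2 := by
        intro j; rw [hek]; dsimp only; split_ifs with hj
        · subst hj; ring
        · ring
      simp_rw [ex, sum_add_distrib, ← mul_sum, hcS, hekS]
      rw [sum_ite_eq' univ k, if_pos (mem_univ _)]; ring
    have hpsd : ∀ s : ℝ, 0 ≤ 2 * s * (lam * c k - G) + s ^ 2 * (lam - q ek) := by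
      intro s
      have := hB (fun j => c j + s * ek j)
      rw [hexp s, hnorm s, hqc] at this
      nlinarith
    have hA := gs_psd_linear_zero hBk hpsd
    -- `λc_k = G = c_k + V(c)_k`
    rw [hG] at hA
    linarith
  -- positivity by connectivity
  have hc0 : ∀ k, 0 ≤ c k := fun k => abs_nonneg _
  have hpos : ∀ k, 0 < c k := by
    by_contra hneg
    push Not at hneg
    obtain ⟨k₀, hk₀⟩ := hneg
    have hck₀ : c k₀ = 0 := le_antisymm hk₀ (hc0 k₀)
    set Z : Finset (Fin (K + 1)) := univ.filter fun k => c k = 0 with hZ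
    have hZne : Z.Nonempty := ⟨k₀, by rw [hZ, mem_filter]; exact ⟨mem_univ _, hck₀⟩⟩
    have hZuniv : Z ≠ univ := by
      intro hZu
      have hall : ∀ k, c k = 0 := fun k => by
        have : k ∈ Z := by rw [hZu]; exact mem_univ k
        rw [hZ, mem_filter] at this; exact this.2
      have : ∑ k : Fin (K + 1), c k ^ 2 = 0 := sum_eq_zero fun k _ => by rw [hall k]; ring
      rw [hcS] at this; exact one_ne_zero this
    obtain ⟨r, hr⟩ := hconn Z hZne hZuniv
    -- an endpoint `i ∈ Z` with the other endpoint `l ∉ Z`: the vertex equation at `i` is a positive sum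
    have key : ∀ (i l : Fin (K + 1)), c i = 0 → 0 < c l → ((e r).1 = i ∧ (e r).2 = l) ∨ ((e r).2 = i ∧ (e r).1 = l) → False := by
      intro i l hi hl hil
      have hil' : i ≠ l := fun h' => by rw [h'] at hi; linarith
      have hv := hvertex i
      have hrhs : -(1 - lam) * c i = 0 := by rw [hi, mul_zero]
      have hif : (if i = 0 then h * c i else 0) = 0 := by rw [hi, mul_zero]; split_ifs <;> rfl
      rw [hrhs, hif, sub_zero] at hv
      -- every term of the vertex sum at `i` is non-negative, the term `r` is `c_l > 0`
      have hterms : ∀ r' : Fin m, 0 ≤ (if i = (e r').1 then c (e r').2 - c (e r').1 else 0) + (if i = (e r').2 then c (e r').1 - c (e r').2 else 0) := by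
        intro r'
        by_cases ha : i = (e r').1 <;> by_cases hb : i = (e r').2
        · rw [if_pos ha, if_pos hb, ← ha, ← hb, hi]; linarith
        · rw [if_pos ha, if_neg hb, ← ha, hi]; linarith [hc0 (e r').2]
        · rw [if_neg ha, if_pos hb, ← hb, hi]; linarith [hc0 (e r').1]
        · rw [if_neg ha, if_neg hb]; linarith
      have hterm : 0 < (if i = (e r).1 then c (e r).2 - c (e r).1 else 0) + (if i = (e r).2 then c (e r).1 - c (e r).2 else 0) := by
        rcases hil with ⟨h1, h2⟩ | ⟨h2, h1⟩
        · rw [if_pos h1.symm, if_neg (by rw [h2]; exact hil'), h1, h2, hi]; linarith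
        · rw [if_neg (by rw [h1]; exact hil'), if_pos h2.symm, h1, h2, hi]; linarith
      have hsum : (if i = (e r).1 then c (e r).2 - c (e r).1 else 0) + (if i = (e r).2 then c (e r).1 - c (e r).2 else 0)
          ≤ ∑ r' : Fin m, ((if i = (e r').1 then c (e r').2 - c (e r').1 else 0) + (if i = (e r').2 then c (e r').1 - c (e r').2 else 0)) :=
        Finset.single_le_sum (fun r' _ => hterms r') (mem_univ r)
      have : 0 < t / m * ∑ r' : Fin m, ((if i = (e r').1 then c (e r').2 - c (e r').1 else 0) + (if i = (e r').2 then c (e r').1 - c (e r').2 else 0)) :=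
        mul_pos (div_pos ht0 hmpos) (lt_of_lt_of_le hterm hsum)
      linarith
    rcases hr with ⟨h1, h2⟩ | ⟨h2, h1⟩
    · have hi : c (e r).1 = 0 := by rw [hZ, mem_filter] at h1; exact h1.2
      have hl : 0 < c (e r).2 := by
        rw [hZ, mem_filter] at h2; push Not at h2
        exact lt_of_le_of_ne (hc0 _) (Ne.symm (h2 (mem_univ _)))
      exact key _ _ hi hl (Or.inl ⟨rfl, rfl⟩)
    · have hi : c (e r).2 = 0 := by rw [hZ, mem_filter] at h2; exact h2.2
      have hl : 0 < c (e r).1 := by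
        rw [hZ, mem_filter] at h1; push Not at h1
        exact lt_of_le_of_ne (hc0 _) (Ne.symm (h1 (mem_univ _)))
      exact key _ _ hi hl (Or.inr ⟨rfl, rfl⟩)
  -- `ρ = 1 − λ = (t/m)Σ(c_i − c_l)² + h c_0² ≥ h c_0² > 0`
  have hρ0 : 0 < 1 - lam := by
    have : lam = 1 - t / m * ∑ r : Fin m, (c (e r).1 - c (e r).2) ^ 2 - h * c 0 ^ 2 := by
      rw [← hqc]; simp only [hq]; rw [hcS]
    rw [this]
    have h1 : 0 ≤ t / m * ∑ r : Fin m, (c (e r).1 - c (e r).2) ^ 2 := mul_nonneg htm (sum_nonneg fun r _ => sq_nonneg _)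
    have h2 : 0 < h * c 0 ^ 2 := mul_pos hh0 (pow_pos (hpos 0) 2)
    linarith
  refine ⟨c, 1 - lam, hpos, hcS, hρ0, by linarith, fun k => ?_⟩
  rw [hvertex k]

end GroundState

end Summit.Ventures.LatticeQCDFlow.Scaling

end
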